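import Summits.CriticalPhenomena.PercolationContinuityZ3.Theorems.PercNearOneGluingNoHeavyLowerTailKnQuestion8AntitheticWedgeQuad
import HarnessLib

/-!
# `NoHeavyLowerTail` (crux stmt-CriticalPhenomena-4575), antithetic vdBHK programme: the wedge gluing `T(X;L)` over an ABSTRACT RELATION — tools for
# iterating THEOREM C (converse heredity of (R)) along the T-tower

Support file (seat `prim-ineq-gen-7` gen 53; `--supports stmt-CriticalPhenomena-4575`).  No `sorry`, no definitions.  Memo: FINDING-UNCROSS-g53.md §3.

`AntitheticWedgePoset` / `AntitheticWedgeQuad` / `AntitheticWedgeConverse` (g51–g52) work over `[PartialOrder X]`.  To ITERATE the wedge gluing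
`X ↦ T(X;L) = X × Fin 4` inside Lean without declaring instances, the order must be carried as an explicit relation `r : X → X → Prop`; the wedge
relation on `X × Fin 4` is then `r p.1 q.1 ∧ SHEET(p,q)` with the sheet condition of `AntitheticWedgePoset` (sheets `0 = RB, 1 = RR, 2 = BB, 3 = BR`;
same sheet, `0→2`, `1→3`, `0→3` always, `2→3` if `p.1 ∈ L`, `0→1` if `q.1 ∉ L`, `1→2` if `p.1 ∈ L ∧ q.1 ∉ L`), the new half is
`L_T = {p : p.2 ≤ 1}` (written as `Finset.univ.filter`), the new involution `p ↦ (ι p.1, s p.2)` with `s = (0 3)(1 2)`.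
* `rel_refl`, `rel_trans`, `rel_half_down`, `rel_invol` — the four structural hypotheses of THEOREM C reproduce themselves one level up: the wedge
  relation is reflexive and transitive (for `r` reflexive, transitive and `L` an `r`-down-set), `L_T` is a down-set for it, `(ι, s)` is an involution.
* `quad_upset_rel` — a sheet-built set `S₀×{0} ∪ S₁×{1} ∪ S₂×{2} ∪ S₃×{3}` whose sheets are `r`-up-sets forming a T-pattern
  (`S₀ ⊆ S₂`, `S₁ ⊆ S₃`, `S₂ ∩ L ⊆ S₃`, `S₀ ∖ L ⊆ S₁`, `x ∈ S₁ ∩ L, r x y, y ∉ L ⟹ y ∈ S₂`) is up-closed for the wedge relation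
  (relation form of `AntitheticWedgeQuad.quad_upset`; the sixth pattern condition `↑(S₂ ∩ L) ∖ L ⊆ S₃` is implied by the third and is not assumed).
-/

namespace Summit.CriticalPhenomena.PercolationContinuityZ3.Theorems

open Finset

namespace AntitheticWedgeQuadRel

variable {X : Type*} [DecidableEq X]

omit [DecidableEq X] in
/-- The wedge relation over a reflexive `r` is reflexive. [this work] -/
theorem rel_refl (r : X → X → Prop) (hrefl : ∀ x, r x x) (L : Finset X) (p : X × Fin 4) :
    (r p.1 p.1 ∧ (p.2 = p.2 ∨ (p.2 = 0 ∧ p.2 = 2) ∨ (p.2 = 1 ∧ p.2 = 3) ∨ (p.2 = 0 ∧ p.2 = 3) ∨ (p.2 = 2 ∧ p.2 = 3 ∧ p.1 ∈ L) ∨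
        (p.2 = 0 ∧ p.2 = 1 ∧ p.1 ∉ L) ∨ (p.2 = 1 ∧ p.2 = 2 ∧ p.1 ∈ L ∧ p.1 ∉ L))) :=
  ⟨hrefl p.1, Or.inl rfl⟩

/-- The wedge relation over a transitive `r` with an `r`-down-set `L` is transitive (64 sheet cases). [this work] -/
theorem rel_trans (r : X → X → Prop) (htrans : ∀ x y z, r x y → r y z → r x z) (L : Finset X)
    (hLdown : ∀ x y : X, r x y → y ∈ L → x ∈ L) (p q w : X × Fin 4)
    (hpq : (r p.1 q.1 ∧ (p.2 = q.2 ∨ (p.2 = 0 ∧ q.2 = 2) ∨ (p.2 = 1 ∧ q.2 = 3) ∨ (p.2 = 0 ∧ q.2 = 3) ∨ (p.2 = 2 ∧ q.2 = 3 ∧ p.1 ∈ L) ∨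
        (p.2 = 0 ∧ q.2 = 1 ∧ q.1 ∉ L) ∨ (p.2 = 1 ∧ q.2 = 2 ∧ p.1 ∈ L ∧ q.1 ∉ L))))
    (hqw : (r q.1 w.1 ∧ (q.2 = w.2 ∨ (q.2 = 0 ∧ w.2 = 2) ∨ (q.2 = 1 ∧ w.2 = 3) ∨ (q.2 = 0 ∧ w.2 = 3) ∨ (q.2 = 2 ∧ w.2 = 3 ∧ q.1 ∈ L) ∨
        (q.2 = 0 ∧ w.2 = 1 ∧ w.1 ∉ L) ∨ (q.2 = 1 ∧ w.2 = 2 ∧ q.1 ∈ L ∧ w.1 ∉ L)))) :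
    (r p.1 w.1 ∧ (p.2 = w.2 ∨ (p.2 = 0 ∧ w.2 = 2) ∨ (p.2 = 1 ∧ w.2 = 3) ∨ (p.2 = 0 ∧ w.2 = 3) ∨ (p.2 = 2 ∧ w.2 = 3 ∧ p.1 ∈ L) ∨
        (p.2 = 0 ∧ w.2 = 1 ∧ w.1 ∉ L) ∨ (p.2 = 1 ∧ w.2 = 2 ∧ p.1 ∈ L ∧ w.1 ∉ L))) := by
  obtain ⟨x, i⟩ := p
  obtain ⟨t, j⟩ := q
  obtain ⟨u, k⟩ := w
  obtain ⟨hxt, c1⟩ := hpq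
  obtain ⟨htu, c2⟩ := hqw
  refine ⟨htrans x t u hxt htu, ?_⟩
  simp only at hxt htu c1 c2 ⊢
  have d1 : t ∈ L → x ∈ L := fun h => hLdown x t hxt h
  have d2 : u ∈ L → t ∈ L := fun h => hLdown t u htu h
  have u1 : x ∉ L → t ∉ L := fun h ht => h (d1 ht)
  have u2 : t ∉ L → u ∉ L := fun h hu => h (d2 hu)
  fin_cases i <;> fin_cases j <;> fin_cases k <;> simp at c1 c2 ⊢ <;> tauto

omit [DecidableEq X] in
/-- The new half `L_T = {p : p.2 ≤ 1}` is a down-set for the wedge relation. [this work] -/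
theorem rel_half_down [Fintype X] (r : X → X → Prop) (L : Finset X) (p q : X × Fin 4)
    (hpq : (r p.1 q.1 ∧ (p.2 = q.2 ∨ (p.2 = 0 ∧ q.2 = 2) ∨ (p.2 = 1 ∧ q.2 = 3) ∨ (p.2 = 0 ∧ q.2 = 3) ∨ (p.2 = 2 ∧ q.2 = 3 ∧ p.1 ∈ L) ∨
        (p.2 = 0 ∧ q.2 = 1 ∧ q.1 ∉ L) ∨ (p.2 = 1 ∧ q.2 = 2 ∧ p.1 ∈ L ∧ q.1 ∉ L))))
    (hq : q ∈ (Finset.univ : Finset (X × Fin 4)).filter (fun q => q.2 ≤ 1)) :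
    p ∈ (Finset.univ : Finset (X × Fin 4)).filter (fun q => q.2 ≤ 1) := by
  obtain ⟨x, i⟩ := p
  obtain ⟨t, j⟩ := q
  obtain ⟨-, c⟩ := hpq
  simp only [Finset.mem_filter, Finset.mem_univ, true_and] at hq c ⊢
  fin_cases i <;> fin_cases j <;> simp at c hq ⊢

omit [DecidableEq X] in
/-- The new involution `(x,i) ↦ (ι x, s i)` (`s = (0 3)(1 2)`) is an involution. [this work] -/
theorem rel_invol (ι : X → X) (hι : Function.Involutive ι) (s : Fin 4 → Fin 4) (hs0 : s 0 = 3) (hs1 : s 1 = 2) (hs2 : s 2 = 1) (hs3 : s 3 = 0) :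
    Function.Involutive (fun p : X × Fin 4 => (ι p.1, s p.2)) := by
  rintro ⟨x, i⟩
  simp only [Prod.mk.injEq]
  refine ⟨hι x, ?_⟩
  fin_cases i <;> simp [hs0, hs1, hs2, hs3]

/-- **Up-closedness of sheet-built sets (relation form).**  If the four sheets are `r`-up-sets forming a T-pattern for `L`, the sheet-built set is
up-closed for the wedge relation. [this work] -/
theorem quad_upset_rel (r : X → X → Prop) (L : Finset X) (S₀ S₁ S₂ S₃ : Finset X)
    (h0 : ∀ x y, r x y → x ∈ S₀ → y ∈ S₀) (h1 : ∀ x y, r x y → x ∈ S₁ → y ∈ S₁)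
    (h2 : ∀ x y, r x y → x ∈ S₂ → y ∈ S₂) (h3 : ∀ x y, r x y → x ∈ S₃ → y ∈ S₃)
    (h02 : S₀ ⊆ S₂) (h13 : S₁ ⊆ S₃) (h23 : ∀ x, x ∈ L → x ∈ S₂ → x ∈ S₃) (h01 : ∀ x, x ∉ L → x ∈ S₀ → x ∈ S₁)
    (hC12 : ∀ x y, r x y → x ∈ L → y ∉ L → x ∈ S₁ → y ∈ S₂) :
    ∀ p q : X × Fin 4,
      (r p.1 q.1 ∧ (p.2 = q.2 ∨ (p.2 = 0 ∧ q.2 = 2) ∨ (p.2 = 1 ∧ q.2 = 3) ∨ (p.2 = 0 ∧ q.2 = 3) ∨ (p.2 = 2 ∧ q.2 = 3 ∧ p.1 ∈ L) ∨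
        (p.2 = 0 ∧ q.2 = 1 ∧ q.1 ∉ L) ∨ (p.2 = 1 ∧ q.2 = 2 ∧ p.1 ∈ L ∧ q.1 ∉ L))) →
      p ∈ S₀ ×ˢ ({0} : Finset (Fin 4)) ∪ S₁ ×ˢ ({1} : Finset (Fin 4)) ∪ S₂ ×ˢ ({2} : Finset (Fin 4)) ∪ S₃ ×ˢ ({3} : Finset (Fin 4)) →
      q ∈ S₀ ×ˢ ({0} : Finset (Fin 4)) ∪ S₁ ×ˢ ({1} : Finset (Fin 4)) ∪ S₂ ×ˢ ({2} : Finset (Fin 4)) ∪ S₃ ×ˢ ({3} : Finset (Fin 4)) := by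
  rintro ⟨x, i⟩ ⟨y, j⟩ ⟨hxy, hc⟩ hp
  simp only at hxy hc
  rw [AntitheticWedgeQuad.mem_quad] at hp ⊢
  -- the RB sheet lies below the BR sheet
  have h03 : ∀ z, z ∈ S₀ → z ∈ S₃ := by
    intro z hz
    by_cases hzL : z ∈ L
    · exact h23 z hzL (h02 hz)
    · exact h13 (h01 z hzL hz)
  rcases hp with ⟨rfl, hm⟩ | ⟨rfl, hm⟩ | ⟨rfl, hm⟩ | ⟨rfl, hm⟩
  · -- source sheet 0 = RB
    have hy0 : y ∈ S₀ := h0 x y hxy hm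
    fin_cases j
    · exact Or.inl ⟨rfl, hy0⟩
    · simp at hc
      exact Or.inr (Or.inl ⟨rfl, h01 y hc hy0⟩)
    · exact Or.inr (Or.inr (Or.inl ⟨rfl, h02 hy0⟩))
    · exact Or.inr (Or.inr (Or.inr ⟨rfl, h03 y hy0⟩))
  · -- source sheet 1 = RR
    have hy1 : y ∈ S₁ := h1 x y hxy hm
    fin_cases j
    · simp at hc
    · exact Or.inr (Or.inl ⟨rfl, hy1⟩)
    · simp at hc
      exact Or.inr (Or.inr (Or.inl ⟨rfl, hC12 x y hxy hc.1 hc.2 hm⟩))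
    · exact Or.inr (Or.inr (Or.inr ⟨rfl, h13 hy1⟩))
  · -- source sheet 2 = BB
    fin_cases j
    · simp at hc
    · simp at hc
    · exact Or.inr (Or.inr (Or.inl ⟨rfl, h2 x y hxy hm⟩))
    · simp at hc
      exact Or.inr (Or.inr (Or.inr ⟨rfl, h3 x y hxy (h23 x hc hm)⟩))
  · -- source sheet 3 = BR
    fin_cases j
    · simp at hc
    · simp at hc
    · simp at hc
    · exact Or.inr (Or.inr (Or.inr ⟨rfl, h3 x y hxy hm⟩))

end AntitheticWedgeQuadRel

end Summit.CriticalPhenomena.PercolationContinuityZ3.Theorems
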